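import Summits.HodgeConjecture.HodgeConjecture.Theorems.HeckePrymWeilWeilDescendingUpward
import Summits.HodgeConjecture.HodgeConjecture.Theorems.HeckePrymWeilProductDescent
import Literature.AlgebraicGeometry.HodgeTheory.WeilClasses
import Literature.AlgebraicGeometry.HodgeTheory.RationalHodgeClasses
import Literature.AlgebraicGeometry.Motives.AbelianVariety
import Literature.AlgebraicGeometry.HodgeTheory.WeilClassesSurfaces
import Literature.AlgebraicGeometry.HodgeTheory.ComplexConjugationHolds
import Literature.AlgebraicGeometry.HodgeTheory.WeilClassesSurfacesAlgebraic

/-!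
# `WeilDescending` (stmt-HodgeConjecture-1263) · II · from `ProductDescent` and the existence of a Weil-type surface

Route `HeckePrymWeil`, support item `WeilDescending`: for a prime `p ≡ 3 (4)`, `p ≥ 7` and `n ≥ 1`,
the rung predicate `HWA(p, n+1)` of `HodgeWeilLadder` implies `HWA(p, n)` (Koike's descending trick,
doi:10.4153/cmb-2004-055-x; Schoen, Compositio Math. 114 (1998) §10; Markman, arXiv:2509.23403
§11.5 Step 2, made component-free). Companion of `HeckePrymWeilWeilDescendingUpward` (upward half:
the rational Weil projector) and of `HeckePrymWeilProductDescent` (the route's support item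
`ProductDescent`: the downward half, Schoen's transfer along the tree's real Gysin maps, for an
ABSTRACT partner surface; proved there conditionally on four named facts, `productDescent_of`).

Given those, `WeilDescending` is pure bookkeeping plus ONE existence statement:

* `weilDescending_of_productDescent` — **`ProductDescent ∧ (Weil-type abelian surfaces with √-d
  exist for every d) ⟹ WeilDescending`** (proved): given `HWA(p, n+1)` and `(A, φ)` of dimension
  `2n`, the partner `(B, ψ, b)` of the existence statement (dimension `2`, `ψ ∘ ψ = -p`, `b ≠ 0` a
  rational `(1,1)` class of the Weil plane `E₊ ⊔ E₋` of `(B, ψ)`) satisfies the hypothesis of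
  `ProductDescent`: `A × B` is an abelian variety of dimension `2(n+1)` with `(φ × ψ)² = -p`
  (`dim_prod_eq_two_mul`, `prodLift_comp_self_eq_neg_zsmul`), so `HWA(p, n+1)` makes every rational
  `(n+1,n+1)` class in the two `(𝟙 + φ × ψ)^*`-eigenspaces of `A × B` algebraic; and the Weil plane of
  `(B, ψ)` (simultaneous eigenclasses of all `(x·𝟙 + y·ψ)^*`, `Literature/…/WeilClasses`) lies in the
  two eigenspaces of the single operator `(𝟙 + ψ)^*` (`x = y = 1`).
* `exists_weilType_abelianSurfaces` — the residual NAMED FACT, stated inline for the gate to file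
  under `Literature/AlgebraicGeometry/HodgeTheory/WeilClassesSurfaces`: for every `d ≥ 1` there is a
  complex abelian surface `B` with `ψ ∘ ψ = -d` and a non-zero rational `(1,1)` class in its Weil
  plane (Schoen's partner `A' = E × E`, `E = ℂ/ℤ[√-d]`, `ψ = (√-d) × (-√-d)`; van Geemen 5.3).
* Consequently the item's statement follows from FIVE named facts — the four of
  `productDescent_of` (`nonempty_hodgeModel`, `exists_deRhamIsoFamily`, `lefschetzOneOne_rational`,
  `hodgeIndex_surface`; file `HeckePrymWeilProductDescent`) and `exists_weilType_abelianSurfaces`: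
  `weilDescending_of_productDescent (productDescent_of hM hdR hL hHI) hW` (one line; to be appended
  here as `weilDescending_of_facts` once that module is built on the farm). CONDITIONAL: the item
  closes only when they are discharged (the Künneth spanning property used by the transfer is
  already a theorem, `kunnethSpan_complexBetti` / `kunneth_span_crossProducts_holds`).

What would make the item unconditional: a CM elliptic curve `E = ℂ/ℤ[√-d]` as an
`AbelianVariety ℂ` with `H¹(E(ℂ))`, `H²((E × E)(ℂ))` computed on the carriers (the existence fact),
GAGA + de Rham + Hodge decomposition (`nonempty_hodgeModel`), de Rham's theorem with wedge = cup
(`exists_deRhamIsoFamily`), Lefschetz `(1,1)` and the Hodge index theorem for surfaces.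

UPDATE (second prover session, 2026-08-16): the existence fact is now PROVED
(`exists_weilType_abelianSurfaces_holds`, `Literature/…/WeilClassesSurfacesProofs`: the COMPANION
surface `E_i × E_i`, `ψ = ((0, -p), (1, 0))`, for ANY elliptic curve — no CM), `nonempty_hodgeModel`
is the tree's `nonempty_hodgeModel_holds`, and the companion surface's Weil class is an ALGEBRAIC
divisor class `b` with `b ∪ b ≠ 0` (`exists_weilType_abelianSurfaces_algebraic`,
`Literature/…/WeilClassesSurfacesAlgebraic`), which serves as its own partner divisor in Schoen's
transfer — so Lefschetz `(1,1)` and the Hodge index theorem drop out too: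

* `weilDescending_of_facts` (4 facts), `weilDescending_of_facts'` (3 facts), and
* **`weilDescending_of_deRham` — `WeilDescending` GRANTED ONLY `exists_deRhamIsoFamily`** (cup = wedge,
  needed for the Hodge type `(n+1,n+1)` of `pr_A^* w ∪ pr_B^* b`; everything else is a theorem).
-/

noncomputable section

-- every declaration of this problem lives in `Summit.HodgeConjecture.HodgeConjecture.…` (summit = sub-problem)
set_option linter.dupNamespace false

open scoped Manifold
open CategoryTheory
open Literature.AlgebraicGeometry Literature.AlgebraicGeometry.HodgeTheory
open Literature.AlgebraicTopology.SingularHomology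

namespace Summit.HodgeConjecture.HodgeConjecture.Theorems

/-! ### The residual named fact -/

/-- **`ProductDescent` and the existence of Weil-type surfaces imply `WeilDescending`.** Given the
route's `ProductDescent` (stmt-HodgeConjecture-14498) and `exists_weilType_abelianSurfaces`: for
`p ≡ 3 (4)` prime, `p ≥ 7`, `n ≥ 1`, the rung `HWA(p, n+1)` implies `HWA(p, n)`. Proof: feed
`ProductDescent` at `(p, n)` with, for every `(A, φ)` of dimension `2n`, the partner `(B, ψ, b)` for
`d = p`; its hypothesis "every rational `(n+1,n+1)` class in the two `(𝟙 + φ×ψ)^*`-eigenspaces of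
`A × B` is algebraic" is `HWA(p, n+1)` applied to the abelian variety `A × B` of dimension `2(n+1)`
with `(φ × ψ)² = -p`; and `b ∈ E₊ ⊔ E₋` lies in the sum of the two `(𝟙+ψ)^*`-eigenspaces
(test endomorphism `x = y = 1`). [cite: Schoen1998HodgeWeilAddendum, §10]
[cite: Markman2025SurveySecant, §11.5 Step 2] -/
theorem weilDescending_of_productDescent (hPD : Theses.HeckePrymWeil.ProductDescent)
    (hW : Literature.AlgebraicGeometry.HodgeTheory.exists_weilType_abelianSurfaces) : Theses.HeckePrymWeil.WeilDescending := by
  intro p hp hp4 hp7 n hn hyp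
  refine hPD p hp hp4 hp7 n hn ?_
  intro A φ hA hφ
  obtain ⟨B, ψ, b, hBdim, hψ, hb0, hbr, hbH, hbW⟩ := hW p (by omega)
  have hψ' : ψ ≫ ψ = -((p : ℤ) • 𝟙 B) := by rw [natCast_zsmul]; exact hψ
  have hBdim' : B.dim = 2 * 1 := by rw [hBdim]
  refine ⟨B, ψ, hBdim, hψ', ⟨b, hb0, hbr, hbH, ?_⟩, ?_⟩
  · -- the Weil plane of `(B, ψ)` lies in the two `(𝟙 + ψ)^*`-eigenspaces
    rw [weilClassesOf, Submodule.mem_sup] at hbW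
    obtain ⟨bp, hbp, bm, hbm, rfl⟩ := hbW
    refine Submodule.add_mem _ (Submodule.mem_sup_left ?_) (Submodule.mem_sup_right ?_)
    · rw [Module.End.mem_eigenspace_iff]
      have e := (mem_weilClassesPlus_iff.mp hbp) 1 1
      simp only [Nat.cast_one, one_mul, one_smul] at e
      exact e
    · rw [Module.End.mem_eigenspace_iff]
      have e := (mem_weilClassesMinus_iff.mp hbm) 1 1
      simp only [Nat.cast_one, one_mul, one_smul] at e
      exact e
  · -- the rung `HWA(p, n+1)` on the abelian variety `A × B` of dimension `2(n+1)`, `(φ × ψ)² = -p`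
    exact hyp (n + 1) rfl (A.prod B) _ (dim_prod_eq_two_mul hA hBdim')
      (prodLift_comp_self_eq_neg_zsmul hφ hψ')

/-! ### `WeilDescending` from the named facts -/

/-- **`WeilDescending` from four named facts of `Literature/`.** For `p ≡ 3 (4)` prime, `p ≥ 7`,
`n ≥ 1`: `HWA(p, n+1) ⟹ HWA(p, n)` (Koike's descending trick, doi:10.4153/cmb-2004-055-x; Schoen,
Compositio 114 (1998) §10; Markman arXiv:2509.23403 §11.5 Step 2), GRANTED exactly: de Rham's
theorem in multiplicative form `exists_deRhamIsoFamily` (the cup product respects Hodge types),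
Lefschetz `(1,1)` `lefschetzOneOne_rational` and the Hodge index theorem `hodgeIndex_surface` (the
algebraic partner divisor of the abstract Weil surface, through `productDescent_of`), and the
existence of Weil-type abelian surfaces `exists_weilType_abelianSurfaces`. The fifth input of the
earlier census, `nonempty_hodgeModel` (GAGA + de Rham + Hodge decomposition), is now the tree's
THEOREM `nonempty_hodgeModel_holds` and is discharged here. One line:
`weilDescending_of_productDescent (productDescent_of …) hW`. CONDITIONAL on the four facts named in
the signature. [cite: Schoen1998HodgeWeilAddendum, §10] [cite: Markman2025SurveySecant, §11.5 Step 2] -/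
theorem weilDescending_of_facts
    (hdR : ∀ (E : Type) [NormedAddCommGroup E] [NormedSpace ℂ E] [FiniteDimensional ℂ E],
      Literature.NumberTheory.Transcendental.exists_deRhamIsoFamily 𝓘(ℝ, E))
    (hL : lefschetzOneOne_rational) (hHI : ∀ X : Motives.SchemeOver ℂ, hodgeIndex_surface X)
    (hW : Literature.AlgebraicGeometry.HodgeTheory.exists_weilType_abelianSurfaces) :
    Theses.HeckePrymWeil.WeilDescending :=
  weilDescending_of_productDescent
    (productDescent_of (fun _ _ ↦ nonempty_hodgeModel_holds) hdR hL hHI) hW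

/-- **`WeilDescending` from THREE named facts**: the existence of Weil-type abelian surfaces is now
the tree's theorem `exists_weilType_abelianSurfaces_holds` (the companion surface `E × E`,
`ψ = ((0, -p), (1, 0))`, `Literature/AlgebraicGeometry/HodgeTheory/WeilClassesSurfacesProofs`).
CONDITIONAL on `exists_deRhamIsoFamily`, `lefschetzOneOne_rational`, `hodgeIndex_surface`.
[cite: Schoen1998HodgeWeilAddendum, §10] [cite: Markman2025SurveySecant, §11.5 Step 2] -/
theorem weilDescending_of_facts'
    (hdR : ∀ (E : Type) [NormedAddCommGroup E] [NormedSpace ℂ E] [FiniteDimensional ℂ E],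
      Literature.NumberTheory.Transcendental.exists_deRhamIsoFamily 𝓘(ℝ, E))
    (hL : lefschetzOneOne_rational) (hHI : ∀ X : Motives.SchemeOver ℂ, hodgeIndex_surface X) :
    Theses.HeckePrymWeil.WeilDescending :=
  weilDescending_of_facts hdR hL hHI exists_weilType_abelianSurfaces_holds

/-! ### `WeilDescending` from de Rham's theorem alone -/

/-- **The Weil class itself is the partner divisor** when it is algebraic with non-zero square: for
a RATIONAL `b = b₊ + b₋` with `g^* b₊ = α b₊`, `g^* b₋ = ᾱ b₋`, `α ≠ ᾱ` and `b ∪ b ≠ 0`, both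
`b₊ ∪ b ≠ 0` and `b₋ ∪ b ≠ 0` (`b₋ ∪ b = conj (b₊ ∪ b)` by `conjClass_eigencomponent_eq`,
`conjClass_cupProduct`, `b` real; and `b ∪ b = b₊ ∪ b + b₋ ∪ b`). This replaces
`exists_algebraic_partner_of_hodgeIndex` (Hodge index + Lefschetz `(1,1)`) for the companion surface.
[cite: Schoen1998HodgeWeilAddendum, §10 (proof of the Proposition, p. 333)] -/
theorem cupProduct_eigencomponents_ne_zero_of_cupProduct_self {B : Motives.SchemeOver ℂ} (g : B ⟶ B) {α : ℂ}
    (hα : α ≠ starRingEnd ℂ α) {bp bm : complexBetti B 2}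
    (hbp : complexBetti.map g 2 bp = α • bp) (hbm : complexBetti.map g 2 bm = starRingEnd ℂ α • bm)
    (hr : IsRationalClass (bp + bm)) (hbb : cupProduct two_add_two (bp + bm) (bp + bm) ≠ 0) :
    cupProduct two_add_two bp (bp + bm) ≠ 0 ∧ cupProduct two_add_two bm (bp + bm) ≠ 0 := by
  have hconj : conjClass (Motives.ComplexPoints B) 2 bp = bm :=
    conjClass_eigencomponent_eq (Motives.AlgPoints.mapContinuous (L := ℂ) g) hα hbp hbm hr
  have hm : cupProduct two_add_two bm (bp + bm) =
      conjClass (Motives.ComplexPoints B) 4 (cupProduct two_add_two bp (bp + bm)) := by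
    rw [conjClass_cupProduct, hconj, hr.conjClass_eq]
  have hsum : cupProduct two_add_two (bp + bm) (bp + bm) =
      cupProduct two_add_two bp (bp + bm) + cupProduct two_add_two bm (bp + bm) := by
    simp only [map_add, LinearMap.add_apply]
    abel
  have hp : cupProduct two_add_two bp (bp + bm) ≠ 0 := by
    intro h
    apply hbb
    rw [hsum, hm, h, conjClass_zero, add_zero]
  refine ⟨hp, ?_⟩
  rw [hm]
  intro h
  apply hp
  rw [← conjClass_conjClass (cupProduct two_add_two bp (bp + bm)), h, conjClass_zero]

/-- **`WeilDescending` GRANTED ONLY de Rham's theorem in multiplicative form** (`exists_deRhamIsoFamily`: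
the cup product of de Rham classes is the wedge product of forms, so that the cup product respects
Hodge types — the one input the tree does not yet prove). For `p ≡ 3 (4)` prime, `p ≥ 7`, `n ≥ 1`:
`HWA(p, n+1) ⟹ HWA(p, n)`. Proof: Schoen's product step (Compositio 114 (1998) §10 = Koike 2004
Thm 2.1 = Markman arXiv:2509.23403 §11.5 Step 2) with the COMPANION Weil surface `B = E_i × E_i`,
`ψ = ((0, -p), (1, 0))` of `exists_weilType_abelianSurfaces_algebraic`, whose rational `(1,1)` Weil
class `b = b₊ + b₋` is an ALGEBRAIC divisor class with `b ∪ b ≠ 0`: (↑) `pr_A^* w± ∪ pr_B^* b±` are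
algebraic on `A × B` by `HWA(p, n+1)` and the rational Weil projector
(`weilEigencomponents_mem_algebraicClasses_of_rung`; the Hodge type `(n+1,n+1)` of
`pr_A^* w ∪ pr_B^* b` is where de Rham's theorem enters, `cupPreservesHodgeType_of_nonempty_hodgeModel`);
(↓) with the partner divisor `t = b` itself (`cupProduct_eigencomponents_ne_zero_of_cupProduct_self`:
`b± ∪ b ≠ 0`; no Hodge index theorem, no Lefschetz `(1,1)`), `(pr_A^* w± ∪ pr_B^* b±) ∪ pr_B^* b` is
algebraic (moving divisors by translations, `AbelianVariety.cupProduct_mem_algebraicClasses_one`) and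
its Gysin image under `pr_A` is `ε± w±` with `ε± ≠ 0` (`complexGysin_fst_map_snd_ne_zero`), along the
tree's real Gysin maps (`mem_algebraicClasses_of_complexGysin_fst_cupProduct`). Everything but
`exists_deRhamIsoFamily` is a theorem of the tree. CONDITIONAL on that single named fact.
[cite: Schoen1998HodgeWeilAddendum, §10 (Proposition and proof, pp. 332–333)]
[cite: Markman2025SurveySecant, §11.5 Step 2] -/
theorem weilDescending_of_deRham
    (hdR : ∀ (E : Type) [NormedAddCommGroup E] [NormedSpace ℂ E] [FiniteDimensional ℂ E],
      Literature.NumberTheory.Transcendental.exists_deRhamIsoFamily 𝓘(ℝ, E)) :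
    Theses.HeckePrymWeil.WeilDescending := by
  intro p _hp hp4 hp7 n hn hyp A φ hAdim hφ c hc hcH hcW
  -- the companion Weil surface with its algebraic Weil divisor class
  obtain ⟨B, ψ, b, hBdim, hψ, hbr, hbH, hbW, hbalg, hbb⟩ := exists_weilType_abelianSurfaces_algebraic p (by omega)
  have hψ' : ψ ≫ ψ = -((p : ℤ) • 𝟙 B) := by rw [natCast_zsmul]; exact hψ
  have hBdim' : B.dim = 2 * 1 := by rw [hBdim]
  -- the rung `HWA(p, n+1)` on `A × B`
  have halgAB := hyp (n + 1) rfl (A.prod B) _ (dim_prod_eq_two_mul hAdim hBdim') (prodLift_comp_self_eq_neg_zsmul hφ hψ')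
  -- smoothness witnesses and the orientation family
  have hp4' : 4 ≤ p := by omega
  have hA : Motives.IsSmoothProjective (2 * n) A.X := isSmoothProjective_of_dim_eq hAdim
  have hB : Motives.IsSmoothProjective (2 * 1) B.X := isSmoothProjective_of_dim_eq hBdim
  have hAB : Motives.IsSmoothProjective (2 * (n + 1)) (A.prod B).X := isSmoothProjective_prod_two_mul hA hB
  have hABt : Motives.IsSmoothProjective (2 * n + 2 * 1) (A.prod B).X :=
    Motives.IsSmoothProjective.tensor_holds hA hB
  let μ : OrientationFamily := fun _ _ h ↦ Classical.choice (Motives.ComplexPoints.isOrientableOver ℂ h)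
  -- shorthands for the two eigenvalues
  set sp : ℂ := 1 + Complex.I * (Real.sqrt (p : ℝ) : ℂ) with hsp
  set sm : ℂ := 1 - Complex.I * (Real.sqrt (p : ℝ) : ℂ) with hsm
  have hconj : starRingEnd ℂ sp = sm := starRingEnd_one_add_I_sqrt p
  -- `w = w₊ + w₋`; `b = b₊ + b₋` along the `(𝟙 + ψ)^*`-eigenvalues (test endomorphism `x = y = 1`)
  obtain ⟨cp, hcp, cm, hcm, rfl⟩ := Submodule.mem_sup.1 hcW
  rw [weilClassesOf, Submodule.mem_sup] at hbW
  obtain ⟨bp, hbp₀, bm, hbm₀, rfl⟩ := hbW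
  have hbp : complexBetti.map (𝟙 B + ψ).hom.hom.hom (2 * 1) bp = sp ^ (2 * 1) • bp := by
    have e := (mem_weilClassesPlus_iff.mp hbp₀) 1 1
    simp only [Nat.cast_one, one_mul, one_smul] at e
    exact e
  have hbm : complexBetti.map (𝟙 B + ψ).hom.hom.hom (2 * 1) bm = sm ^ (2 * 1) • bm := by
    have e := (mem_weilClassesMinus_iff.mp hbm₀) 1 1
    simp only [Nat.cast_one, one_mul, one_smul] at e
    exact e
  rw [Module.End.mem_eigenspace_iff] at hcp hcm
  -- the compatible endomorphism `Φ = φ × ψ`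
  set Φ : A.prod B ⟶ A.prod B := Motives.AbelianVariety.prodLift (Motives.AbelianVariety.fst A B ≫ φ)
    (Motives.AbelianVariety.snd A B ≫ ψ) with hΦ
  have h₁ : Φ ≫ Motives.AbelianVariety.fst A B = Motives.AbelianVariety.fst A B ≫ φ :=
    Motives.AbelianVariety.prodLift_fst _ _
  have h₂ : Φ ≫ Motives.AbelianVariety.snd A B = Motives.AbelianVariety.snd A B ≫ ψ :=
    Motives.AbelianVariety.prodLift_snd _ _
  -- Hodge type `(n+1, n+1)` of `P = pr_A^* w ∪ pr_B^* b` (de Rham's theorem enters here, and only here)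
  have hI := hodgePQ_independent_of_hodgeModel_holds
  have hfst : PreservesHodgeType (2 * n + 2 * 1) (2 * n) (Motives.AbelianVariety.fst A B).hom.hom.hom :=
    preservesHodgeType_of_nonempty_hodgeModel hI nonempty_hodgeModel_holds hABt hA _
  have hsnd : PreservesHodgeType (2 * n + 2 * 1) (2 * 1) (Motives.AbelianVariety.snd A B).hom.hom.hom :=
    preservesHodgeType_of_nonempty_hodgeModel hI nonempty_hodgeModel_holds hABt hB _
  have hcupH : CupPreservesHodgeType (2 * n + 2 * 1) (A.prod B).X :=
    cupPreservesHodgeType_of_nonempty_hodgeModel hI nonempty_hodgeModel_holds hdR hABt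
  have h : 2 * n + 2 * 1 = 2 * (n + 1) := by ring
  have hH : IsOfHodgeType (2 * (n + 1)) (A.prod B).X (2 * (n + 1)) (n + 1) (n + 1)
      (cupProduct h (complexBetti.map (Motives.AbelianVariety.fst A B).hom.hom.hom (2 * n) (cp + cm))
        (complexBetti.map (Motives.AbelianVariety.snd A B).hom.hom.hom (2 * 1) (bp + bm))) :=
    isOfHodgeType_cupProduct_map_fst_map_snd h hfst hsnd hcupH hcH hbH
  -- upward half: `pr_A^* w± ∪ pr_B^* b±` are algebraic on `A × B`
  obtain ⟨hP, hMm⟩ := weilEigencomponents_mem_algebraicClasses_of_rung h₁ h₂ hp4' hn h hAB halgAB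
    hcp hcm hbp hbm hc hbr hH
  -- the partner divisor is `b` itself: `b± ∪ b ≠ 0`
  have hx₂ : sp ^ (2 * 1) ≠ sm ^ (2 * 1) := WeilTwelvefoldsSqrtMinus7.Negative.one_add_I_sqrt_pow_ne p hp4' (2 * 1) (by omega)
  have hα : sp ^ (2 * 1) ≠ starRingEnd ℂ (sp ^ (2 * 1)) := by rwa [map_pow, hconj]
  have hbm' : complexBetti.map (𝟙 B + ψ).hom.hom.hom 2 bm = starRingEnd ℂ (sp ^ (2 * 1)) • bm := by
    rw [map_pow, hconj]; exact hbm
  have hbb' : cupProduct two_add_two (bp + bm) (bp + bm) ≠ 0 := hbb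
  obtain ⟨hpt, hmt⟩ := cupProduct_eigencomponents_ne_zero_of_cupProduct_self (𝟙 B + ψ).hom.hom.hom hα hbp hbm' hbr hbb'
  -- `pr_B^* b` is algebraic on `A × B`, hence so are `(pr_A^* w± ∪ pr_B^* b±) ∪ pr_B^* b`
  have hbalg' : bp + bm ∈ algebraicClasses B.X 1 := hbalg
  have ht' : complexBetti.map (Motives.AbelianVariety.snd A B).hom.hom.hom (2 * 1) (bp + bm) ∈
      algebraicClasses (A.prod B).X 1 :=
    map_snd_mem_supportedClasses hA hB hbalg'
  have halgp := AbelianVariety.cupProduct_mem_algebraicClasses_one (A.prod B) hP ht'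
  have halgm := AbelianVariety.cupProduct_mem_algebraicClasses_one (A.prod B) hMm ht'
  -- the fibre integrals `pr_{A*} pr_B^*(b± ∪ b) ≠ 0`
  have hjj' : 2 * 1 + 2 * 1 = 2 * (2 * 1) := rfl
  have hpt' : cupProduct hjj' bp (bp + bm) ≠ 0 := hpt
  have hmt' : cupProduct hjj' bm (bp + bm) ≠ 0 := hmt
  have hnep := complexGysin_fst_map_snd_ne_zero μ hA hB hpt'
  have hnem := complexGysin_fst_map_snd_ne_zero μ hA hB hmt'
  -- Schoen's transfer, component by component
  refine Submodule.add_mem _ ?_ ?_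
  · exact mem_algebraicClasses_of_complexGysin_fst_cupProduct μ hA hB (l := n) (j := 2 * 1)
      (j' := 2 * 1) (s := 2 * (n + 1)) h hjj' hnep halgp
  · exact mem_algebraicClasses_of_complexGysin_fst_cupProduct μ hA hB (l := n) (j := 2 * 1)
      (j' := 2 * 1) (s := 2 * (n + 1)) h hjj' hnem halgm

end Summit.HodgeConjecture.HodgeConjecture.Theorems

end
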